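import Literature.NumberTheory.EllipticCurves.Kato2004.EulerSystemClasses
import Literature.NumberTheory.EllipticCurves.Kato2004.IwasawaCohomologyZetaLift
import HarnessLib

/-!
# Kato 2004 (Astérisque 295) §13.1 / Ex. 13.3 / Thm. 13.4: the Λ-adic lift of a `ZetaBody` family IS a
# genuine Euler-system class (`IsEulerSystemClass`) — PROVED (theorems only; no definition, no named fact)

Topic `NumberTheory/EllipticCurves`, sub-directory `Kato2004` (namespace = path).  Seat `bsd-potss-rkm` g15
(prover; cell `bsd-potss`, item stmt-BirchSwinnertonDyer-19196 `ReducibleKatoMember` = crux M of K9 / K8-t′;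
`--supports`, closes nothing).  HONEST FRAMING: BSD is not advanced; nothing is booked.

WHY.  The tree carries Kato's Euler-system machinery in two vocabularies that were never joined:
(1) the `ZetaBody` families of `EulerSystemValues.lean` — Kato's `(c,d,a(A))`-zeta elements with their
values (facts `exists_eulerSystem_expStar_values`, `exists_member_eulerSystem_expStar_values` = Z0, and the
member-free transport `forall_exists_zetaBody_of_member`, rkm g14) — whose `p`-power line has a UNIQUE
Λ-adic lift `𝐲 ∈ 𝐇¹_Γ(T_pW)` (`IwasawaH1Data.existsUnique_lift_of_zetaBody`, rkm g2); and
(2) the predicate `IsEulerSystemClass W p κ γ I s` of `EulerSystemClasses.lean` (cell `bsd-smallim`) — the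
hypothesis under which Kato's GENERAL Euler-system bound Thm. 13.4 (2)(3) is typed
(`Kato2004.thm13_4_lengthAt_fineSelmerDual_le_of_isEulerSystemClass`, `EulerSystemBoundFineSelmer.lean`) and
which the Kobayashi / Sprung packages assert of their zeta classes as a FIELD.
This file proves that (1) ⟹ (2): **the Λ-adic lift of any `ZetaBody` family is an `IsEulerSystemClass`**
(`isEulerSystemClass_of_zetaBody`), so Thm. 13.4 applies BY NAME to Kato's own zeta class obtained from Z0
(no package field needed).  Ingredients, all in the tree: (C1) of `ZetaBody` = `IsEulerSystem` on the
cyclotomic levels away from `badPlaces c d A N`; (C2) = membership of EVERY class in `integralH1` (the two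
predicates are literally the same vanishing-on-inertia condition, §8.2/Lemma 8.5); the lift's defining
equation `proj n 𝐲 = Cor_{ℚ(μ_{p^{n+1}})/ℚ_n}(z_{n+1,∅})` with `levelToLayer = coresToLayer` (both are the
tree's `coresLe`); finiteness of `badPlaces c d A N` when `2cdAN ≠ 0` (the admissible data of the facts have
`(c, 6pA) = (d, 6pN) = 1`, `A ≥ 1`, `N ≥ 1`).

References: K. Kato, Astérisque 295 (2004): §13.1 (13.1.1), Ex. 13.3 (pp. 224–225), Thm. 13.4 (p. 226)
(«let `Z` be the `Λ`-submodule of `𝐇¹(T)` generated by `(z_{p^n})_n`»), §13.8 (p. 228), (8.1.3), §8.2 and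
Lemma 8.5 (pp. 180–184) [Kato2004Asterisque]; K. Rubin, *Euler Systems* (2000) Def. 2.1.1 [Rubin2000]; tree
`Kato2004/{EulerSystemValues, EulerSystemClasses, IwasawaCohomologyZetaLift, IwasawaCohomologyEulerSystemLift}.lean`.
-/

set_option autoImplicit false

noncomputable section

open scoped NumberField TensorProduct
open Field IsDedekindDomain
open Literature.NumberTheory.GaloisRepresentations
open Literature.NumberTheory.EllipticCurves Literature.NumberTheory.EllipticCurves.ModularForms
open Literature.NumberTheory.EllipticCurves.Kato2004.EulerSystemValues Rat.HeightOneSpectrum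

namespace Literature.NumberTheory.EllipticCurves.Kato2004

/-! ## `badPlaces c d A N` is finite for admissible data -/

/-- The bad set `prime(2cdAN)` of Ex. 13.3 is finite as soon as `2cdAN ≠ 0` (finitely many primes divide a
non-zero integer). [cite: Kato2004Asterisque, §13.1 and Ex. 13.3 (pp. 224–225) (Σ = prime(cdpAN) is finite)] -/
theorem badPlaces_finite {c d : ℤ} {A N : ℕ} (h : 2 * c.natAbs * d.natAbs * A * N ≠ 0) :
    (badPlaces c d A N).Finite := by
  have hfin : {q : Nat.Primes | (q : ℕ) ∣ 2 * c.natAbs * d.natAbs * A * N}.Finite := by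
    refine Set.Finite.of_finite_image (f := fun q : Nat.Primes ↦ (q : ℕ)) ?_
      (Nat.Primes.coe_nat_injective.injOn)
    refine (Nat.divisors (2 * c.natAbs * d.natAbs * A * N)).finite_toSet.subset ?_
    rintro _ ⟨q, hq, rfl⟩
    exact Finset.mem_coe.mpr (Nat.mem_divisors.mpr ⟨hq, h⟩)
  have : badPlaces c d A N = primesEquiv ⁻¹' {q : Nat.Primes | (q : ℕ) ∣ 2 * c.natAbs * d.natAbs * A * N} := by
    ext v; simp [badPlaces]
  rw [this]
  exact hfin.preimage primesEquiv.injective.injOn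

/-! ## The lift of the `p`-power line of an integral Euler system is an `IsEulerSystemClass` -/

section Lift

variable (W : WeierstrassCurve ℚ) [W.IsElliptic] (p : ℕ) [Fact p.Prime]
  [ContinuousSMul ℤ_[p] (W.tateModule p)] [Module.Free ℤ_[p] (W.tateModule p)]
  [Module.Finite ℤ_[p] (W.tateModule p)]
  {κ : ZpExtension ℚ p} (hκ : κ.IsCyclotomic) (hp : p ≠ 2) {γ : absoluteGaloisGroup ℚ}
  (I : IwasawaH1Data W p κ γ)

omit [Module.Free ℤ_[p] (W.tateModule p)] [Module.Finite ℤ_[p] (W.tateModule p)] in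
/-- The two packagings of `Cor_{ℚ(μ_{p^{n+1}})/ℚ_n}` agree: `levelToLayer` (the zeta-lift files) is
`coresToLayer` (the `IsEulerSystemClass` predicate) along `Gal(ℚ̄/ℚ(μ_{p^{n+1}})) ≤ Gal(ℚ̄/ℚ_n)`.
[cite: Kato2004Asterisque, §13.8 (p. 228) (the trace to the Δ-trivial component)] -/
theorem levelToLayer_eq_coresToLayer (S : Set (HeightOneSpectrum (𝓞 ℚ))) (n : ℕ) :
    levelToLayer W p hκ hp S n =
      coresToLayer W p κ ((cyclotomicLevelsRat p S).isOpen_level (n + 1) ∅) n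
        (hκ.cyclotomicLevelsRat_level_succ_le_layerSubgroup hp S n) := rfl

/-- **The Λ-adic lift of the `p`-power line of an INTEGRAL Euler system is a genuine Euler-system class.**
If `z` is an Euler system for `T_pW` over the cyclotomic levels away from a finite `S`, all of whose
classes are integral, and `y ∈ 𝐇¹_Γ(T_pW)` satisfies `proj n y = Cor_{ℚ(μ_{p^{n+1}})/ℚ_n}(z_{n+1,∅})` for
every `n`, then `IsEulerSystemClass W p κ γ I y`. [cite: Kato2004Asterisque, §13.1 (13.1.1), Thm. 13.4 (p. 226) and §13.8 (p. 228)]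
[cite: Rubin2000, Def. 2.1.1] -/
theorem isEulerSystemClass_of_proj_eq_levelToLayer {S : Set (HeightOneSpectrum (𝓞 ℚ))} (hS : S.Finite)
    {z : ∀ (k : ℕ) (r : (cyclotomicLevelsRat p S).Ideals), H1 (tateRep W p) ((cyclotomicLevelsRat p S).level k r.1)}
    (hz : IsEulerSystem (cyclotomicLevelsRat p S) (tateRep W p) p z)
    (hint : ∀ (k : ℕ) (r : (cyclotomicLevelsRat p S).Ideals),
      z k r ∈ integralH1 (tateRep W p) p ((cyclotomicLevelsRat p S).level k r.1))
    {y : I.H} (hy : ∀ n : ℕ, I.proj n y = levelToLayer W p hκ hp S n (z (n + 1) (cyclotomicLevelsRat p S).idealOne)) :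
    IsEulerSystemClass W p κ γ I y :=
  ⟨S, hS, z, hz, hint, fun n ↦ hκ.cyclotomicLevelsRat_level_succ_le_layerSubgroup hp S n, fun n ↦ by
    rw [hy n, levelToLayer_eq_coresToLayer]⟩

/-- **Kato's `(c,d,a(A))`-zeta family lifts to a genuine Euler-system class.**  For a `ZetaBody` witness
`(κ', Λ', z, x)` (Kato's Euler system for `T_pW` with its values, (8.1.3)/Ex. 13.3) with `2cdAN ≠ 0`, any
`y ∈ 𝐇¹_Γ(T_pW)` with `proj n y = Cor(z_{n+1,∅})` for all `n` — in particular THE lift of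
`IwasawaH1Data.existsUnique_lift_of_zetaBody` — satisfies `IsEulerSystemClass W p κ γ I y`: (C1) is the Euler
system, (C2) is the integrality of every class. [cite: Kato2004Asterisque, Ex. 13.3 (p. 225), (8.1.3) and Lemma 8.5 (pp. 180–184), Thm. 13.4 (p. 226)] -/
theorem isEulerSystemClass_of_zetaBody {N : ℕ} {f : CuspForm (CongruenceSubgroup.Gamma0 N) 2}
    {ι : (m : ℕ) → (CyclotomicField m ℚ →+* ℂ)} {κ' : ℝ}
    {Λ' : ∀ (k : ℕ) (r : Finset (HeightOneSpectrum (𝓞 ℚ))),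
      H1 (tateRep W p) (cycSubgroup p k r) →ₗ[ℤ_[p]] ℚ_[p] ⊗[ℚ] CyclotomicField (cycLevel p k r) ℚ}
    {c d a : ℤ} {A : ℕ}
    {z : ∀ (k : ℕ) (r : (cyclotomicLevelsRat p (badPlaces c d A N)).Ideals),
      H1 (tateRep W p) ((cyclotomicLevelsRat p (badPlaces c d A N)).level k r.1)}
    {x : ∀ (k : ℕ) (r : (cyclotomicLevelsRat p (badPlaces c d A N)).Ideals),
      CyclotomicField (cycLevel p k r.1) ℚ}
    (hbody : ZetaBody W p f ι κ' Λ' c d a A z x) (hne : 2 * c.natAbs * d.natAbs * A * N ≠ 0)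
    {y : I.H} (hy : ∀ n : ℕ, I.proj n y = levelToLayer W p hκ hp (badPlaces c d A N) n
      (z (n + 1) (cyclotomicLevelsRat p (badPlaces c d A N)).idealOne)) :
    IsEulerSystemClass W p κ γ I y :=
  isEulerSystemClass_of_proj_eq_levelToLayer W p hκ hp I (badPlaces_finite hne) hbody.1
    (fun k r v hv 𝔓 h𝔓 ↦ hbody.2.1 k r v hv 𝔓 h𝔓) hy

/-- **Existence form**: every `ZetaBody` family with `2cdAN ≠ 0` has a (unique) Λ-adic lift, and that
lift is a genuine Euler-system class. [cite: Kato2004Asterisque, §13.1 and Thm. 13.4 (pp. 224–226), Ex. 13.3 (p. 225)] -/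
theorem exists_isEulerSystemClass_of_zetaBody {N : ℕ} (f : CuspForm (CongruenceSubgroup.Gamma0 N) 2)
    (ι : (m : ℕ) → (CyclotomicField m ℚ →+* ℂ)) (κ' : ℝ)
    (Λ' : ∀ (k : ℕ) (r : Finset (HeightOneSpectrum (𝓞 ℚ))),
      H1 (tateRep W p) (cycSubgroup p k r) →ₗ[ℤ_[p]] ℚ_[p] ⊗[ℚ] CyclotomicField (cycLevel p k r) ℚ)
    (c d a : ℤ) (A : ℕ)
    (z : ∀ (k : ℕ) (r : (cyclotomicLevelsRat p (badPlaces c d A N)).Ideals),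
      H1 (tateRep W p) ((cyclotomicLevelsRat p (badPlaces c d A N)).level k r.1))
    (x : ∀ (k : ℕ) (r : (cyclotomicLevelsRat p (badPlaces c d A N)).Ideals),
      CyclotomicField (cycLevel p k r.1) ℚ)
    (hbody : ZetaBody W p f ι κ' Λ' c d a A z x) (hne : 2 * c.natAbs * d.natAbs * A * N ≠ 0) :
    ∃ y : I.H, IsEulerSystemClass W p κ γ I y ∧
      ∀ n : ℕ, I.proj n y = levelToLayer W p hκ hp (badPlaces c d A N) n
        (z (n + 1) (cyclotomicLevelsRat p (badPlaces c d A N)).idealOne) := by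
  obtain ⟨y, hy, -⟩ := IwasawaH1Data.existsUnique_lift_of_zetaBody p W hκ hp I f ι κ' Λ' c d a A z x hbody
  exact ⟨y, isEulerSystemClass_of_zetaBody W p hκ hp I hbody hne hy, hy⟩

end Lift

end Literature.NumberTheory.EllipticCurves.Kato2004

end
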